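import Summits.QuantumFields.YangMills.Theorems.BalabanUVNodesPortS1G3CTwinGeom
import Summits.QuantumFields.YangMills.Theorems.BalabanUVNodesPortS1G3CTwinLocal

/-!
# NODE O port PT-A, offer (ζ) for `stub_G3C` of 27930 — RESTRICTION TO THE INDICES OF `X` AND REINDEXING ALONG `twinIdxEquiv`: the torus factors of the walk terms read on the integer
# index (`T_Y ↦ TZ_Ŷ`, `P_□̃ ↦ P̂`, `𝟙_□ ↦ 𝟙̂`, `Σ_{Y ⊆ Z} ↦ Σ_{Ŷ ⊆ Ẑ}`)

Cell `ym-nodeO-ideate`, porter seat `ymgap-nodeO-port-PTA-1` (gen 8), on ★★★ director-ym №573 (2); `--supports stmt-QuantumFields-27930` (helper, P0-free).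
[I] = [Balaban1987RG1], [B9] = [Balaban1985BackgroundPropagators].

* §1 generic: restriction `A ↦ A|_P` to a sub-index is multiplicative against factors vanishing off `P` (`submatrix_mul_of_col_zero`, `submatrix_listProd_of_col_zero`), keeps the trace
  (`trace_eq_trace_submatrix_of_diag_zero`); `reindex_mul_reindex`, `listProd_map_reindex` (the trace under `reindex` is ✓`TubeZeroFreeChannel.trace_reindex_eq`, inlined where used); support propagation `col_zero_mul`, `row_zero_mul`.
* §2 ★ `sum_subdom_eq_sum_powerset_intCubes` — a sum over the sub-domains `Y ⊆ Z` equals the sum over `𝒫(X̂_K(Z))` of any function vanishing at non-lifts ((Z-dom)).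
* §3 at the record, off the wrap class, with `e := twinIdxEquiv`: `twinCube_symm_mem_iff` (`InDom Z (e⁻¹ î) ↔ twinCube î ∈ X̂_K(Z)`), ★ `twinMat_intCubes_eq_reindex`, ★ `g3cProjZ_eq_reindex`,
  ★ `g3cIndZ_eq_reindex`, and the supports of the torus factors off the indices of `X` (`nonB0Block_zero_off`, `g3cProj_zero_off`, `g3cInd_zero_off`, `g3cLocInv_zero_off`).

HONEST FRAMING.  Index bookkeeping over DISPLAYED clauses of the P0-ℂ body (inhabited nowhere); NOTHING of Bałaban's estimates asserted, ported or discharged; `stub_G3C` OPEN; 27930 OPEN · no claim;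
NODE O 0∕1; COUNT 8∕28 · K 1∕4 UNMOVED; finite `𝕋⁴_{L^K}` at fixed ε — NOT continuum ∕ OS ∕ Clay; **the Yang–Mills mass gap is NOT proved by any of this.**  No `sorry`, no `instance`, no `notation`;
standard axioms.
-/

noncomputable section

open scoped BigOperators
open Finset

namespace Summit.QuantumFields.YangMills.Theorems.BalabanUVNodesPortS1

open Summit.QuantumFields.YangMills.Theorems.K0RecordFormatNames
open Literature.MathematicalPhysics.QuantumFieldTheory.Balaban1983to89
open Literature.MathematicalPhysics.QuantumFieldTheory.Balaban1983to89.Node00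
open Literature.MathematicalPhysics.QuantumFieldTheory.Balaban1983to89.T4Continuum (T4Family)
open Literature.MathematicalPhysics.QuantumFieldTheory.Balaban1983to89.TreeLengthTorus (TPt IsTDom proj)
open Literature.MathematicalPhysics.QuantumLattice (blockMap blockSites mem_blockSites_iff)

/-! ## §1  Generic restriction ∕ reindexing algebra -/

section Generic

variable {S : Type*} [Fintype S] (P : S → Prop)

/-- Columns vanishing off `P` propagate to the left through products. [folklore] -/
theorem col_zero_mul (A B : Matrix S S ℂ) (hB : ∀ s l, ¬ P l → B s l = 0) : ∀ s l, ¬ P l → (A * B) s l = 0 := by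
  intro s l hl
  rw [Matrix.mul_apply]
  exact Finset.sum_eq_zero fun t _ => by rw [hB t l hl, mul_zero]

/-- Rows vanishing off `P` propagate to the right through products. [folklore] -/
theorem row_zero_mul (A B : Matrix S S ℂ) (hA : ∀ s l, ¬ P s → A s l = 0) : ∀ s l, ¬ P s → (A * B) s l = 0 := by
  intro s l hs
  rw [Matrix.mul_apply]
  exact Finset.sum_eq_zero fun t _ => by rw [hA s t hs, zero_mul]

/-- **Restriction is multiplicative** against a left factor whose columns vanish off `P`. [folklore] -/
theorem submatrix_mul_of_col_zero [DecidablePred P] (A B : Matrix S S ℂ) (hA : ∀ s l, ¬ P l → A s l = 0) :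
    (A * B).submatrix (Subtype.val : {s // P s} → S) (Subtype.val : {s // P s} → S) =
      A.submatrix (Subtype.val : {s // P s} → S) (Subtype.val : {s // P s} → S) * B.submatrix (Subtype.val : {s // P s} → S) (Subtype.val : {s // P s} → S) := by
  ext a b
  simp only [Matrix.submatrix_apply, Matrix.mul_apply]
  exact sum_eq_sum_subtype_of_zero P _ fun l hl => by rw [hA _ _ hl, zero_mul]

/-- **Restriction is multiplicative on lists** of factors whose columns vanish off `P`. [folklore] -/
theorem submatrix_listProd_of_col_zero [DecidablePred P] [DecidableEq S] :
    ∀ l : List (Matrix S S ℂ), (∀ A ∈ l, ∀ s t, ¬ P t → A s t = 0) →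
      l.prod.submatrix (Subtype.val : {s // P s} → S) (Subtype.val : {s // P s} → S) =
        (l.map fun A => A.submatrix (Subtype.val : {s // P s} → S) (Subtype.val : {s // P s} → S)).prod
  | [], _ => by rw [List.prod_nil, List.map_nil, List.prod_nil]; exact Matrix.submatrix_one _ Subtype.val_injective
  | A :: l, h => by
      rw [List.prod_cons, List.map_cons, List.prod_cons, submatrix_mul_of_col_zero P A _ (h A (by simp)),
        submatrix_listProd_of_col_zero l fun B hB => h B (by simp [hB])]

/-- **The trace is the trace of the restriction** when the diagonal vanishes off `P`. [folklore] -/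
theorem trace_eq_trace_submatrix_of_diag_zero [DecidablePred P] (A : Matrix S S ℂ) (hA : ∀ s, ¬ P s → A s s = 0) :
    A.trace = (A.submatrix (Subtype.val : {s // P s} → S) (Subtype.val : {s // P s} → S)).trace := by
  simp only [Matrix.trace, Matrix.diag, Matrix.submatrix_apply]
  exact sum_eq_sum_subtype_of_zero P _ hA

/-- Reindexing along an equivalence is multiplicative. [folklore] -/
theorem reindex_mul_reindex {m n : Type*} [Fintype m] [Fintype n] (e : m ≃ n) (A B : Matrix m m ℂ) :
    Matrix.reindex e e A * Matrix.reindex e e B = Matrix.reindex e e (A * B) := by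
  simp only [Matrix.reindex_apply]
  exact Matrix.submatrix_mul_equiv A B e.symm e.symm e.symm

/-- Reindexing a list product. [folklore] -/
theorem listProd_map_reindex {m n : Type*} [Fintype m] [Fintype n] [DecidableEq m] [DecidableEq n] (e : m ≃ n) :
    ∀ l : List (Matrix m m ℂ), (l.map fun A => Matrix.reindex e e A).prod = Matrix.reindex e e l.prod
  | [] => by rw [List.map_nil, List.prod_nil, List.prod_nil, Matrix.reindex_apply, Matrix.submatrix_one_equiv]
  | A :: l => by rw [List.map_cons, List.prod_cons, List.prod_cons, listProd_map_reindex e l, reindex_mul_reindex]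

end Generic

/-! ## §2  Sums over sub-domains versus sums over the power set of the lift -/

section Sums

variable {F : T4Family}

/-- ★ **`Σ_{Y ⊆ Z} g(X̂_K(Y)) = Σ_{Ŷ ⊆ X̂_K(Z)} g(Ŷ)`** for every `g` vanishing at the subsets of `X̂_K(Z)` that are not lifts of sub-domains of `Z` (the home of (Z-dom)).
[cite: Balaban1987RG1, (1.21) p.264, (1.7) p.261] -/
theorem sum_subdom_eq_sum_powerset_intCubes {Mc k K : ℕ} {M : Type*} [AddCommMonoid M] (Z : (recordDomSys F Mc k K).Dom) (g : Finset (Fin 4 → ℤ) → M)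
    (hg : ∀ Yh, Yh ⊆ intCubes F Mc k K Z → (∀ Y : (recordDomSys F Mc k K).Dom, (Y.1 : Finset (TPt (F.P K).d (Sect2.domCount (F.P K) Mc (k + 1)))) ⊆ Z.1 → intCubes F Mc k K Y ≠ Yh) → g Yh = 0) :
    ∑ Y ∈ (Finset.univ : Finset (recordDomSys F Mc k K).Dom).filter (fun Y => (Y.1 : Finset (TPt (F.P K).d (Sect2.domCount (F.P K) Mc (k + 1)))) ⊆ Z.1), g (intCubes F Mc k K Y) =
      ∑ Yh ∈ (intCubes F Mc k K Z).powerset, g Yh := by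
  classical
  have hinj : Set.InjOn (intCubes F Mc k K)
      ↑((Finset.univ : Finset (recordDomSys F Mc k K).Dom).filter (fun Y => (Y.1 : Finset (TPt (F.P K).d (Sect2.domCount (F.P K) Mc (k + 1)))) ⊆ Z.1)) :=
    fun Y _ Y' _ h => Subtype.ext (Finset.Subset.antisymm (subset_of_intCubes_subset h.le) (subset_of_intCubes_subset h.ge))
  rw [← Finset.sum_image (f := g) hinj]
  refine Finset.sum_subset (fun Yh hYh => ?_) (fun Yh hYh hnot => ?_)
  · obtain ⟨Y, hY, rfl⟩ := Finset.mem_image.1 hYh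
    exact Finset.mem_powerset.2 (Finset.image_subset_image (Finset.mem_filter.1 hY).2)
  · refine hg Yh (Finset.mem_powerset.1 hYh) fun Y hY h => hnot ?_
    exact Finset.mem_image.2 ⟨Y, Finset.mem_filter.2 ⟨Finset.mem_univ _, hY⟩, h⟩

end Sums

/-! ## §3  The torus factors on the integer index -/

section Record

variable {F : T4Family}
variable {Mc k K : ℕ} (hMc : McGuard F Mc) (hK : recordK₀ F Mc k ≤ K) {X : (recordDomSys F Mc k K).Dom} (hX : X ∉ recordWrapCtr F Mc k K)

/-- The cube of `e s` is the centred representative of the cube of `s`. [cite: Balaban1987RG1, (1.21) p.264 (bookkeeping)] -/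
theorem twinCube_twinIdxEquiv (s : {s : NonB0Idx F k K // cubeOfSite F Mc k K (blockOf s.1.1.src) ∈ (X.1 : Finset (TPt (F.P K).d (Sect2.domCount (F.P K) Mc (k + 1))))}) :
    twinCube F Mc (twinIdxEquiv hMc hK X hX s) = fun i => ((cubeOfSite F Mc k K (blockOf s.1.1.1.src) i).valMinAbs : ℤ) :=
  blockMap_twinIdxEquiv hMc hK X hX s

/-- The cube of an integer index is the centred representative of the cube of `e⁻¹ î`. [cite: Balaban1987RG1, (1.21) p.264 (bookkeeping)] -/
theorem twinCube_eq_symm (i : TwinIdx F Mc (intCubes F Mc k K X)) :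
    twinCube F Mc i = fun j => ((cubeOfSite F Mc k K (blockOf ((twinIdxEquiv hMc hK X hX).symm i).1.1.1.src) j).valMinAbs : ℤ) := by
  have h := twinCube_twinIdxEquiv hMc hK hX ((twinIdxEquiv hMc hK X hX).symm i)
  rwa [Equiv.apply_symm_apply] at h

/-- ★ **Cube predicates transport**: the cube of `e⁻¹ î` lies in the sub-domain `Z` iff the integer cube of `î` lies in `X̂_K(Z)`. [cite: Balaban1987RG1, (1.21) p.264, (1.7) p.261] -/
theorem cube_symm_mem_iff (Z : (recordDomSys F Mc k K).Dom) (i : TwinIdx F Mc (intCubes F Mc k K X)) :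
    cubeOfSite F Mc k K (blockOf ((twinIdxEquiv hMc hK X hX).symm i).1.1.1.src) ∈ (Z.1 : Finset (TPt (F.P K).d (Sect2.domCount (F.P K) Mc (k + 1)))) ↔
      twinCube F Mc i ∈ intCubes F Mc k K Z := by
  rw [twinCube_eq_symm hMc hK hX i]
  exact ((valMinAbs_lift_injective _).mem_finset_image).symm

/-- ★ `g3cInDom Z (e⁻¹ î) ↔ twinCube î ∈ X̂_K(Z)`. [cite: Balaban1987RG1, (1.7) p.261, (1.21) p.264] -/
theorem g3cInDom_symm_iff (Z : (recordDomSys F Mc k K).Dom) (i : TwinIdx F Mc (intCubes F Mc k K X)) :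
    g3cInDom F Mc k K Z ((twinIdxEquiv hMc hK X hX).symm i).1 ↔ twinCube F Mc i ∈ intCubes F Mc k K Z :=
  ⟨fun h => (cube_symm_mem_iff hMc hK hX Z i).1 (cubeOfSite_blockOf_mem_of_embIter_mem_domSites hMc hK Z _ h),
    fun h => embIter_mem_domSites_of_cubeOfSite_mem hMc hK Z _ ((cube_symm_mem_iff hMc hK hX Z i).2 h)⟩

/-- `cube (e⁻¹ î) = q ↔ twinCube î = ι q`. [cite: Balaban1987RG1, (1.21) p.264 (bookkeeping)] -/
theorem cube_symm_eq_iff (q : TPt (F.P K).d (Sect2.domCount (F.P K) Mc (k + 1))) (i : TwinIdx F Mc (intCubes F Mc k K X)) :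
    cubeOfSite F Mc k K (blockOf ((twinIdxEquiv hMc hK X hX).symm i).1.1.1.src) = q ↔ twinCube F Mc i = fun j => ((q j).valMinAbs : ℤ) := by
  rw [twinCube_eq_symm hMc hK hX i]
  exact ⟨fun h => by rw [h], fun h => valMinAbs_lift_injective _ h⟩

variable (TYK : (recordDomSys F Mc k K).Dom → Sect2.CPair (F.P K) (MatA 2) → FluctIdx F k K → FluctIdx F k K → ℂ)
  (TZY : Finset (Fin 4 → ℤ) → IntBondCfg → ((Fin 4 → ℤ) × Fin 4) × Fin 3 → ((Fin 4 → ℤ) × Fin 4) × Fin 3 → ℂ) (φ : Sect2.CPair (F.P K) (MatA 2))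

/-- ★ **`TZ_{X̂_K(Y)}(φ ∘ π) = e ∘ T_Y(φ)|_X ∘ e⁻¹`** for `Y ⊆ X` (✓`twinMat_eq_reindex`, with the restriction written as a `submatrix` of `nonB0Block`). [cite: Balaban1987RG1, (1.21) p.264, (1.7) p.261] -/
theorem twinMat_intCubes_eq_reindex
    (hZsupp : ∀ (Xh : Finset (Fin 4 → ℤ)) (f : IntBondCfg) (bi bj : (Fin 4 → ℤ) × Fin 4) (a a' : Fin 3),
      (blockMap (F.L * Mc) bi.1 ∉ Xh ∨ blockMap (F.L * Mc) bj.1 ∉ Xh) → TZY Xh f (bi, a) (bj, a') = 0)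
    (hZbr : ∀ (Y : (recordDomSys F Mc k K).Dom), Y ∉ recordWrapCtr F Mc k K →
      ∀ (ψ : Sect2.CPair (F.P K) (MatA 2)) (bi bj : (Fin 4 → ℤ) × Fin 4) (a a' : Fin 3),
        blockMap (F.L * Mc) bi.1 ∈ intCubes F Mc k K Y → blockMap (F.L * Mc) bj.1 ∈ intCubes F Mc k K Y →
          TYK Y ψ (coverBondAt (F.P K) k bi, a) (coverBondAt (F.P K) k bj, a') = TZY (intCubes F Mc k K Y) (pullPair F K ψ) (bi, a) (bj, a'))
    (hsupp : ∀ Y ψ (s s' : NonB0Idx F k K),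
      (cubeOfSite F Mc k K (blockOf s.1.1.src) ∉ (Y.1 : Finset (TPt (F.P K).d (Sect2.domCount (F.P K) Mc (k + 1)))) ∨
        cubeOfSite F Mc k K (blockOf s'.1.1.src) ∉ (Y.1 : Finset (TPt (F.P K).d (Sect2.domCount (F.P K) Mc (k + 1))))) → TYK Y ψ s.1 s'.1 = 0)
    {Y : (recordDomSys F Mc k K).Dom} (hYX : (Y.1 : Finset (TPt (F.P K).d (Sect2.domCount (F.P K) Mc (k + 1)))) ⊆ X.1) :
    twinMat F Mc TZY (intCubes F Mc k K X) (intCubes F Mc k K Y) (pullPair F K φ) =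
      Matrix.reindex (twinIdxEquiv hMc hK X hX) (twinIdxEquiv hMc hK X hX)
        ((nonB0Block F k K (TYK Y φ)).submatrix Subtype.val Subtype.val) := by
  rw [twinMat_eq_reindex hMc hK hX TYK TZY φ hZsupp hZbr hsupp hYX]
  rfl

/-- ★ **`P̂_{X̂_K(Z)} = e ∘ P_Z|_X ∘ e⁻¹`.** [cite: Balaban1985BackgroundPropagators, (3.87) p.409; Balaban1987RG1, (1.21) p.264] -/
theorem g3cProjZ_eq_reindex (Z : (recordDomSys F Mc k K).Dom) :
    g3cProjZ F Mc (intCubes F Mc k K X) (intCubes F Mc k K Z) =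
      Matrix.reindex (twinIdxEquiv hMc hK X hX) (twinIdxEquiv hMc hK X hX) ((g3cProj F Mc k K Z).submatrix Subtype.val Subtype.val) := by
  classical
  ext i j
  rw [Matrix.reindex_apply, Matrix.submatrix_apply, Matrix.submatrix_apply]
  unfold g3cProjZ g3cProj
  by_cases hij : i = j
  · subst hij
    rw [Matrix.diagonal_apply_eq, Matrix.diagonal_apply_eq]
    have hiff := g3cInDom_symm_iff hMc hK hX Z i
    split_ifs with h1 h2 h2
    · rfl
    · exact absurd (hiff.2 h1) h2
    · exact absurd (hiff.1 h2) h1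
    · rfl
  · have hij' : ((twinIdxEquiv hMc hK X hX).symm i).1 ≠ ((twinIdxEquiv hMc hK X hX).symm j).1 :=
      fun h => hij ((twinIdxEquiv hMc hK X hX).symm.injective (Subtype.ext h))
    rw [Matrix.diagonal_apply_ne _ hij, Matrix.diagonal_apply_ne _ hij']

/-- ★ **`𝟙̂_{ι q} = e ∘ 𝟙_q|_X ∘ e⁻¹`.** [cite: Balaban1985BackgroundPropagators, (3.87) p.409; Balaban1987RG1, (1.21) p.264] -/
theorem g3cIndZ_eq_reindex (q : TPt (F.P K).d (Sect2.domCount (F.P K) Mc (k + 1))) :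
    g3cIndZ F Mc (intCubes F Mc k K X) (fun j => ((q j).valMinAbs : ℤ)) =
      Matrix.reindex (twinIdxEquiv hMc hK X hX) (twinIdxEquiv hMc hK X hX) ((g3cInd F Mc k K q).submatrix Subtype.val Subtype.val) := by
  classical
  ext i j
  rw [Matrix.reindex_apply, Matrix.submatrix_apply, Matrix.submatrix_apply]
  unfold g3cIndZ g3cInd
  by_cases hij : i = j
  · subst hij
    rw [Matrix.diagonal_apply_eq, Matrix.diagonal_apply_eq]
    have hiff := cube_symm_eq_iff hMc hK hX q i
    split_ifs with h1 h2 h2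
    · rfl
    · exact absurd (hiff.2 h1) h2
    · exact absurd (hiff.1 h2) h1
    · rfl
  · have hij' : ((twinIdxEquiv hMc hK X hX).symm i).1 ≠ ((twinIdxEquiv hMc hK X hX).symm j).1 :=
      fun h => hij ((twinIdxEquiv hMc hK X hX).symm.injective (Subtype.ext h))
    rw [Matrix.diagonal_apply_ne _ hij, Matrix.diagonal_apply_ne _ hij']

/-! ### Supports of the torus factors off the indices of `X` -/

/-- `T_Y(φ)` (`Y ⊆ X`) vanishes off the indices of `X` ((P4-supp)). [cite: Balaban1987RG1, (1.7) p.261] -/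
theorem nonB0Block_zero_off
    (hsupp : ∀ Y ψ (s s' : NonB0Idx F k K),
      (cubeOfSite F Mc k K (blockOf s.1.1.src) ∉ (Y.1 : Finset (TPt (F.P K).d (Sect2.domCount (F.P K) Mc (k + 1)))) ∨
        cubeOfSite F Mc k K (blockOf s'.1.1.src) ∉ (Y.1 : Finset (TPt (F.P K).d (Sect2.domCount (F.P K) Mc (k + 1))))) → TYK Y ψ s.1 s'.1 = 0)
    {Y : (recordDomSys F Mc k K).Dom} (hYX : (Y.1 : Finset (TPt (F.P K).d (Sect2.domCount (F.P K) Mc (k + 1)))) ⊆ X.1) (s s' : NonB0Idx F k K)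
    (h : cubeOfSite F Mc k K (blockOf s.1.1.src) ∉ (X.1 : Finset (TPt (F.P K).d (Sect2.domCount (F.P K) Mc (k + 1)))) ∨
      cubeOfSite F Mc k K (blockOf s'.1.1.src) ∉ (X.1 : Finset (TPt (F.P K).d (Sect2.domCount (F.P K) Mc (k + 1))))) :
    nonB0Block F k K (TYK Y φ) s s' = 0 :=
  hsupp Y φ s s' (h.imp (fun h1 h2 => h1 (hYX h2)) (fun h1 h2 => h1 (hYX h2)))

include hMc hK in
/-- `P_Z` (`Z ⊆ X`) vanishes off the indices of `X`. [cite: Balaban1985BackgroundPropagators, (3.87) p.409] -/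
theorem g3cProj_zero_off {Z : (recordDomSys F Mc k K).Dom} (hZX : (Z.1 : Finset (TPt (F.P K).d (Sect2.domCount (F.P K) Mc (k + 1)))) ⊆ X.1) (s s' : NonB0Idx F k K)
    (h : cubeOfSite F Mc k K (blockOf s.1.1.src) ∉ (X.1 : Finset (TPt (F.P K).d (Sect2.domCount (F.P K) Mc (k + 1)))) ∨
      cubeOfSite F Mc k K (blockOf s'.1.1.src) ∉ (X.1 : Finset (TPt (F.P K).d (Sect2.domCount (F.P K) Mc (k + 1))))) :
    g3cProj F Mc k K Z s s' = 0 := by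
  classical
  unfold g3cProj
  by_cases hss : s = s'
  · subst hss
    rw [Matrix.diagonal_apply_eq, if_neg]
    intro hin
    have hc := cubeOfSite_blockOf_mem_of_embIter_mem_domSites hMc hK Z _ hin
    rcases h with h | h <;> exact h (hZX hc)
  · exact Matrix.diagonal_apply_ne _ hss

/-- `𝟙_q` (`q ∈ X`) vanishes off the indices of `X`. [cite: Balaban1985BackgroundPropagators, (3.87) p.409] -/
theorem g3cInd_zero_off {q : TPt (F.P K).d (Sect2.domCount (F.P K) Mc (k + 1))} (hq : q ∈ (X.1 : Finset (TPt (F.P K).d (Sect2.domCount (F.P K) Mc (k + 1))))) (s s' : NonB0Idx F k K)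
    (h : cubeOfSite F Mc k K (blockOf s.1.1.src) ∉ (X.1 : Finset (TPt (F.P K).d (Sect2.domCount (F.P K) Mc (k + 1)))) ∨
      cubeOfSite F Mc k K (blockOf s'.1.1.src) ∉ (X.1 : Finset (TPt (F.P K).d (Sect2.domCount (F.P K) Mc (k + 1))))) :
    g3cInd F Mc k K q s s' = 0 := by
  classical
  unfold g3cInd
  by_cases hss : s = s'
  · subst hss
    rw [Matrix.diagonal_apply_eq, if_neg, Complex.ofReal_zero]
    rintro rfl
    rcases h with h | h <;> exact h hq
  · exact Matrix.diagonal_apply_ne _ hss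

include hMc hK in
/-- `G_Z` (`Z ⊆ X`) vanishes off the indices of `X`. [cite: Balaban1985BackgroundPropagators, (3.88) p.409] -/
theorem g3cLocInv_zero_off (x : ℝ) {Z : (recordDomSys F Mc k K).Dom} (hZX : (Z.1 : Finset (TPt (F.P K).d (Sect2.domCount (F.P K) Mc (k + 1)))) ⊆ X.1) (s s' : NonB0Idx F k K)
    (h : cubeOfSite F Mc k K (blockOf s.1.1.src) ∉ (X.1 : Finset (TPt (F.P K).d (Sect2.domCount (F.P K) Mc (k + 1)))) ∨
      cubeOfSite F Mc k K (blockOf s'.1.1.src) ∉ (X.1 : Finset (TPt (F.P K).d (Sect2.domCount (F.P K) Mc (k + 1))))) :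
    g3cLocInv F Mc k K TYK Z x φ s s' = 0 :=
  g3cLocInv_apply_of_not_mem Mc k K TYK Z x φ
    (h.imp (fun h1 h2 => h1 (hZX (cubeOfSite_blockOf_mem_of_embIter_mem_domSites hMc hK Z _ h2)))
      (fun h1 h2 => h1 (hZX (cubeOfSite_blockOf_mem_of_embIter_mem_domSites hMc hK Z _ h2))))

end Record

end Summit.QuantumFields.YangMills.Theorems.BalabanUVNodesPortS1

end
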